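import Summits.BirchSwinnertonDyer.Rank1Residual.X2.GreenbergVatsalTorsion
import Literature.NumberTheory.EllipticCurves.DiscreteH1Equiv
import HarnessLib

/-!
# `S^{Σ₀}_N(L)` depends only on the isomorphism class of the Galois module `N` with its datum:
# Greenberg–Vatsal's "the order of this group is independent of `i` since `A₁[p] ≅ A₂[p]`"

HONEST FRAMING (cell `b2b-bsdres`, run/shared/lean/b2b/bsd-rank1-residual/, verbatim in every
file): the goal of the cell is to DELETE the COMBINATION-SHAPED residual classes of the
Birch–Swinnerton-Dyer formula for ALL analytic-rank `≤ 1` elliptic curves over `ℚ` — "full BSD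
formula for every rank `≤ 1` curve in class `C`" assembled STRICTLY from published theorems — so
that the rank-`≤ 1` remainder becomes exactly the CONSTRUCTION-SHAPED classes, which are TYPED
(missing-input `Prop`s), NOT attempted. This is not "finishing BSD". Sub-cell
`b2b-bsdres-eisenstein-p2` (CLASS-OWNERS row "X2"), gen 8: research route; NO CLAIM BEYOND STATED
CLASSES; nothing here changes a label. Every declaration is a definition with a body or a proved
theorem; NO named fact, nothing asserted.

WHAT THIS FILE PROVES (the last formal step of GV's `λ`-transfer, arXiv:math/9906215 pp. 26–27:
"by proposition (2.8), we have
`Sel^{Σ₀}_{E_i}(ℚ_∞)[p] = S^{Σ₀}_{A_i}(ℚ_∞)[p] ≅ S^{Σ₀}_{A_i[p]}(ℚ_∞)`.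
Furthermore, the order of this group is independent of `i` since `A₁[p] ≅ A₂[p]` as
`G_ℚ`-modules"; p. 26: "for an odd prime `p`, the group `S_{A[p]}(ℚ_∞)` is determined just by the
isomorphism class of `A[p]` as a `G_ℚ`-module … `C[p] = μ_p` and `D[p]` is the maximal quotient of
`A[p]` on which `I_p` acts trivially"). For two discrete `Γ_K`-modules `N₁`, `N₂` with Greenberg
data `D₁`, `D₂` above `p` and a `Γ_K`-equivariant isomorphism `θ : N₁ ≃ N₂` carrying `N₁⁺_v` onto
`N₂⁺_v` for every `v ∣ p` (for `N_i = E_i[p]`, `p` odd: automatic, `C_i[p]` being THE line on which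
`I_p` acts by `ω` — supplied per pair, as in GV):
* `conjH1_h1Equiv` — `θ_*` commutes with the conjugation action; `mem_unramKer_iff_h1Equiv`,
  `mem_greenbergKer_iff_h1Equiv` — each local condition corresponds under `θ_* = h1Equiv θ`
  (`DiscreteH1Equiv.mem_resKer_iff_h1Equiv_mem`);
* **`mem_gvSelmer_iff_h1Equiv`**, **`natCard_gvSelmer_eq_of_equiv`**: `θ_*` maps `S^{Σ₀}_{N₁}(L)`
  onto `S^{Σ₀}_{N₂}(L)`; `#S^{Σ₀}_{N₁}(L) = #S^{Σ₀}_{N₂}(L)`;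
* **`natCard_gvSelmer_inf_torsion_mul_eq`** — with `X2/GreenbergVatsalTorsion.lean`: for
  `n`-divisible `M₁`, `M₂` (unramified outside `Σ₀ ∪ {v ∣ p}`, `I_v` trivial on `M_i/M_i⁺`, finite
  `M_i^H`) and `θ : M₁[n] ≃ M₂[n]` equivariant carrying `M₁[n] ∩ M₁⁺` onto `M₂[n] ∩ M₂⁺`:
  **`#(S^{Σ₀}_{M₁}(L) ⊓ H¹[n]) · #M₁^H[n] = #(S^{Σ₀}_{M₂}(L) ⊓ H¹[n]) · #M₂^H[n]`** — i.e., once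
  the PRINTED second half of Prop. (2.8) (`#S^{Σ₀}_{A_i}[p] = p^{λ^{Σ₀}_i}` when `μ_i = 0`, via
  Prop. (2.5)) is fed in, **`λ^{Σ₀}_{E₁} + t₁ = λ^{Σ₀}_{E₂} + t₂`**, `t_i = dim_{𝔽_p} E_i(ℚ_∞)[p]`:
  the `E(ℚ)[p]`-corrected congruence invariant behind route G's typed `CongruentLambdaShift` on the
  `φ = 1` classes (flag `GV-Prop28-H0-remark`, referee R98.2 (β)).

References: Greenberg–Vatsal, Invent. Math. 142 (2000) = arXiv:math/9906215, §2 pp. 25–27;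
Serre, *Galois Cohomology*, I.§2.4 (functoriality of `H¹` in compatible pairs).
-/

noncomputable section

open scoped Classical AddSubgroup

open NumberField IsDedekindDomain Field
open Literature.NumberTheory.EllipticCurves Literature.NumberTheory.EllipticCurves.GreenbergSelmer
  Literature.NumberTheory.GaloisRepresentations
  Summit.BirchSwinnertonDyer.Rank1Residual.X2.TorsionComparison
  Summit.BirchSwinnertonDyer.Rank1Residual.X2.GreenbergVatsalTorsion

universe u

namespace Summit.BirchSwinnertonDyer.Rank1Residual.X2.GreenbergVatsalTorsionIso

variable {K : Type u} [Field K] [NumberField K]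
variable (H : Subgroup (absoluteGaloisGroup K))
variable {N₁ : Type u} [AddCommGroup N₁] [DistribMulAction (absoluteGaloisGroup K) N₁]
  [TopologicalSpace N₁] [DiscreteTopology N₁]
variable {N₂ : Type u} [AddCommGroup N₂] [DistribMulAction (absoluteGaloisGroup K) N₂]
  [TopologicalSpace N₂] [DiscreteTopology N₂]
variable (θ : N₁ ≃+ N₂)

/-! ## §1. `θ_* = h1Equiv θ` on `H¹(H, ·)` and the conjugation action -/

omit [NumberField K] [TopologicalSpace N₁] [DiscreteTopology N₁] [TopologicalSpace N₂]
  [DiscreteTopology N₂] in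
/-- `θ` is `H`-equivariant. [folklore] -/
theorem equivariant_subgroup (hθ : ∀ (g : absoluteGaloisGroup K) (m : N₁), θ (g • m) = g • θ m)
    (g : H) (m : N₁) : θ (g • m) = g • θ m :=
  hθ g m

/-- **`θ_* : H¹(H, N₁) ≃+ H¹(H, N₂)`** (`DiscreteH1Equiv.h1Equiv` for the subgroup `H`).
Serre, *Galois Cohomology*, I.§2.4. [folklore] -/
def h1EquivSub (hθ : ∀ (g : absoluteGaloisGroup K) (m : N₁), θ (g • m) = g • θ m) :
    subgroupH1 H N₁ ≃+ subgroupH1 H N₂ :=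
  h1Equiv θ (equivariant_subgroup H θ hθ)

omit [NumberField K] in
/-- `θ_*` commutes with the conjugation action of `Γ_K` (both are maps of the compatible pair
`(h ↦ σ⁻¹ h σ, m ↦ σ • θ m = θ (σ • m))`). [folklore] -/
theorem conjH1_h1Equiv (hθ : ∀ (g : absoluteGaloisGroup K) (m : N₁), θ (g • m) = g • θ m)
    [H.Normal] (σ : absoluteGaloisGroup K) (c : subgroupH1 H N₁) :
    conjH1 H N₂ σ (h1EquivSub H θ hθ c) = h1EquivSub H θ hθ (conjH1 H N₁ σ c) := by
  rw [h1EquivSub, h1Equiv_apply, h1Equiv_apply, conjH1, conjH1, resH1Hom_resH1Hom,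
    resH1Hom_resH1Hom]
  exact congrFun (congrArg DFunLike.coe
    (resH1Hom_congr (by ext; rfl) (by ext m; exact (hθ σ m).symm) _ _)) c

/-! ## §2. Local conditions correspond under `θ_*` -/

/-- The unramified condition at `v` corresponds under `θ_*`. [folklore] -/
theorem mem_unramKer_iff_h1Equiv (hθ : ∀ (g : absoluteGaloisGroup K) (m : N₁), θ (g • m) = g • θ m)
    (v : HeightOneSpectrum (𝓞 K)) (c : subgroupH1 H N₁) :
    c ∈ unramKer H N₁ v ↔ h1EquivSub H θ hθ c ∈ unramKer H N₂ v := by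
  rw [unramKer, unramKer, ← resKer_eq_ker, ← resKer_eq_ker, h1EquivSub]
  exact mem_resKer_iff_h1Equiv_mem (inertiaInToH H v) (AddMonoidHom.id N₁) (fun _ _ ↦ rfl)
    (AddMonoidHom.id N₂) (fun _ _ ↦ rfl) θ (equivariant_subgroup H θ hθ) θ
    (fun x n ↦ hθ _ n) (fun _ ↦ rfl) c

variable {v : HeightOneSpectrum (𝓞 K)} (D₁ : LocalDatum K N₁ v) (D₂ : LocalDatum K N₂ v)

/-- **`θ̄ : N₁/N₁⁺_v ≃+ N₂/N₂⁺_v`** induced by `θ` when `θ(N₁⁺_v) = N₂⁺_v`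
(Mathlib's `QuotientAddGroup.congr` on the tree's `LocalDatum.Gr`). [folklore] -/
def grCongr (hθD : D₁.plus.map (θ : N₁ →+ N₂) = D₂.plus) : D₁.Gr ≃+ D₂.Gr :=
  QuotientAddGroup.congr D₁.plus D₂.plus θ hθD

omit [TopologicalSpace N₁] [DiscreteTopology N₁] [TopologicalSpace N₂] [DiscreteTopology N₂] in
/-- `θ̄` on classes. [folklore] -/
@[simp]
theorem grCongr_grMk (hθD : D₁.plus.map (θ : N₁ →+ N₂) = D₂.plus) (m : N₁) :
    grCongr θ D₁ D₂ hθD (D₁.grMk m) = D₂.grMk (θ m) :=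
  rfl

omit [TopologicalSpace N₁] [DiscreteTopology N₁] [TopologicalSpace N₂] [DiscreteTopology N₂] in
/-- `θ̄` is `D_v`-equivariant, hence `H ⊓ I_v`-equivariant. [folklore] -/
theorem grCongr_smul (hθD : D₁.plus.map (θ : N₁ →+ N₂) = D₂.plus)
    (hθ : ∀ (g : absoluteGaloisGroup K) (m : N₁), θ (g • m) = g • θ m) (x : inertiaIn H v)
    (q : D₁.Gr) :
    grCongr θ D₁ D₂ hθD (x • q) = x • grCongr θ D₁ D₂ hθD q := by
  obtain ⟨m, rfl⟩ := D₁.grMk_surjective q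
  rw [Subgroup.smul_def, Subgroup.smul_def, LocalDatum.smul_grMk, grCongr_grMk, grCongr_grMk,
    LocalDatum.smul_grMk, hθ]

/-- Greenberg's condition at `v ∣ p` corresponds under `θ_*` (given `θ(N₁⁺_v) = N₂⁺_v`).
[folklore] -/
theorem mem_greenbergKer_iff_h1Equiv (hθD : D₁.plus.map (θ : N₁ →+ N₂) = D₂.plus)
    (hθ : ∀ (g : absoluteGaloisGroup K) (m : N₁), θ (g • m) = g • θ m) (c : subgroupH1 H N₁) :
    c ∈ D₁.greenbergKer H ↔ h1EquivSub H θ hθ c ∈ D₂.greenbergKer H := by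
  rw [LocalDatum.greenbergKer, LocalDatum.greenbergKer, LocalDatum.greenbergMap,
    LocalDatum.greenbergMap, ← resKer_eq_ker, ← resKer_eq_ker, h1EquivSub]
  exact mem_resKer_iff_h1Equiv_mem (inertiaInToH H v) D₁.grMk (fun _ _ ↦ rfl) D₂.grMk
    (fun _ _ ↦ rfl) θ (equivariant_subgroup H θ hθ) (grCongr θ D₁ D₂ hθD)
    (grCongr_smul H θ D₁ D₂ hθD hθ) (fun _ ↦ rfl) c

/-! ## §3. `S^{Σ₀}_N(L)` is an isomorphism invariant of `(N, (N⁺_v)_v)` -/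

section Selmer

variable [H.Normal] {p : ℕ} (L₁ : Data K N₁ p) (L₂ : Data K N₂ p)
  (S₀ : Set (HeightOneSpectrum (𝓞 K)))

/-- **`c ∈ S^{Σ₀}_{N₁}(L) ↔ θ_* c ∈ S^{Σ₀}_{N₂}(L)`** for a `Γ_K`-isomorphism `θ : N₁ ≃ N₂`
carrying the data `N₁⁺_v` onto `N₂⁺_v` (`v ∣ p`). [cite: GreenbergVatsal2000, §2 pp. 26–27] -/
theorem mem_gvSelmer_iff_h1Equiv
    (hθL : ∀ (v : HeightOneSpectrum (𝓞 K)) (hv : ((p : ℕ) : 𝓞 K) ∈ v.asIdeal),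
      (L₁ v hv).plus.map (θ : N₁ →+ N₂) = (L₂ v hv).plus)
    (hθ : ∀ (g : absoluteGaloisGroup K) (m : N₁), θ (g • m) = g • θ m) (c : subgroupH1 H N₁) :
    c ∈ gvSelmer H N₁ p L₁ S₀ ↔ h1EquivSub H θ hθ c ∈ gvSelmer H N₂ p L₂ S₀ := by
  rw [mem_gvSelmer_iff, mem_gvSelmer_iff]
  refine and_congr (forall₄_congr fun v _ _ σ ↦ ?_) (forall₃_congr fun v hv σ ↦ ?_)
  · rw [conjH1_h1Equiv, mem_unramKer_iff_h1Equiv H θ hθ v]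
  · rw [conjH1_h1Equiv]
    exact mem_greenbergKer_iff_h1Equiv H θ (L₁ v hv) (L₂ v hv) (hθL v hv) hθ _

/-- **`θ_*(S^{Σ₀}_{N₁}(L)) = S^{Σ₀}_{N₂}(L)`**. [cite: GreenbergVatsal2000, §2 pp. 26–27] -/
theorem map_gvSelmer_h1Equiv
    (hθL : ∀ (v : HeightOneSpectrum (𝓞 K)) (hv : ((p : ℕ) : 𝓞 K) ∈ v.asIdeal),
      (L₁ v hv).plus.map (θ : N₁ →+ N₂) = (L₂ v hv).plus)
    (hθ : ∀ (g : absoluteGaloisGroup K) (m : N₁), θ (g • m) = g • θ m) :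
    (gvSelmer H N₁ p L₁ S₀).map (h1EquivSub H θ hθ : subgroupH1 H N₁ →+ subgroupH1 H N₂) =
      gvSelmer H N₂ p L₂ S₀ := by
  ext c
  rw [AddSubgroup.mem_map]
  constructor
  · rintro ⟨c₁, hc₁, rfl⟩
    exact (mem_gvSelmer_iff_h1Equiv H θ L₁ L₂ S₀ hθL hθ c₁).1 hc₁
  · intro hc
    refine ⟨(h1EquivSub H θ hθ).symm c, ?_, AddEquiv.apply_symm_apply _ c⟩
    rw [mem_gvSelmer_iff_h1Equiv H θ L₁ L₂ S₀ hθL hθ, AddEquiv.apply_symm_apply]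
    exact hc

/-- **`S^{Σ₀}_{N₁}(L) ≃+ S^{Σ₀}_{N₂}(L)`** along `θ_*`. [cite: GreenbergVatsal2000, §2 pp. 26–27] -/
def gvSelmerCongr
    (hθL : ∀ (v : HeightOneSpectrum (𝓞 K)) (hv : ((p : ℕ) : 𝓞 K) ∈ v.asIdeal),
      (L₁ v hv).plus.map (θ : N₁ →+ N₂) = (L₂ v hv).plus)
    (hθ : ∀ (g : absoluteGaloisGroup K) (m : N₁), θ (g • m) = g • θ m) :
    gvSelmer H N₁ p L₁ S₀ ≃+ gvSelmer H N₂ p L₂ S₀ :=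
  ((h1EquivSub H θ hθ).addSubgroupMap (gvSelmer H N₁ p L₁ S₀)).trans
    (AddEquiv.addSubgroupCongr (map_gvSelmer_h1Equiv H θ L₁ L₂ S₀ hθL hθ))

/-- **"The order of this group is independent of `i`"**: `#S^{Σ₀}_{N₁}(L) = #S^{Σ₀}_{N₂}(L)`.
[cite: GreenbergVatsal2000, §2 p. 27] -/
theorem natCard_gvSelmer_eq_of_equiv
    (hθL : ∀ (v : HeightOneSpectrum (𝓞 K)) (hv : ((p : ℕ) : 𝓞 K) ∈ v.asIdeal),
      (L₁ v hv).plus.map (θ : N₁ →+ N₂) = (L₂ v hv).plus)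
    (hθ : ∀ (g : absoluteGaloisGroup K) (m : N₁), θ (g • m) = g • θ m) :
    Nat.card (gvSelmer H N₁ p L₁ S₀) = Nat.card (gvSelmer H N₂ p L₂ S₀) :=
  Nat.card_congr (gvSelmerCongr H θ L₁ L₂ S₀ hθL hθ).toEquiv

end Selmer

end Summit.BirchSwinnertonDyer.Rank1Residual.X2.GreenbergVatsalTorsionIso

/-! ## §4. The `H⁰`-corrected congruence invariant `#S^{Σ₀}_M(L)[n] · #M^H[n]` -/

namespace Summit.BirchSwinnertonDyer.Rank1Residual.X2.GreenbergVatsalTorsionIso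

variable {K : Type u} [Field K] [NumberField K]
variable (H : Subgroup (absoluteGaloisGroup K)) [H.Normal]
variable (M₁ : Type u) [AddCommGroup M₁] [DistribMulAction (absoluteGaloisGroup K) M₁]
  [TopologicalSpace M₁] [DiscreteTopology M₁]
variable (M₂ : Type u) [AddCommGroup M₂] [DistribMulAction (absoluteGaloisGroup K) M₂]
  [TopologicalSpace M₂] [DiscreteTopology M₂]
variable (p : ℕ) (L₁ : Data K M₁ p) (L₂ : Data K M₂ p) (S₀ : Set (HeightOneSpectrum (𝓞 K))) (n : ℕ)

/-- **Greenberg–Vatsal's comparison WITHOUT `H⁰ = 0`, two modules.** Let `M₁`, `M₂` be `n`-divisible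
discrete `Γ_K`-modules with continuous orbit maps, unramified at the finite `v ∉ Σ₀`, `v ∤ p`, with
Greenberg data on whose graded pieces `I_v` acts trivially (`v ∣ p`), with finite invariants
`M_i^H = H⁰(L, M_i)`, and let `θ : M₁[n] ≃ M₂[n]` be a `Γ_K`-isomorphism carrying `M₁[n] ∩ M₁⁺_v`
onto `M₂[n] ∩ M₂⁺_v` (`v ∣ p`). Then
**`#(S^{Σ₀}_{M₁}(L) ⊓ H¹(H,M₁)[n]) · #M₁^H[n] = #(S^{Σ₀}_{M₂}(L) ⊓ H¹(H,M₂)[n]) · #M₂^H[n]`**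
(both sides equal `#S^{Σ₀}_{M_i[n]}(L)`, `natCard_gvSelmer_torsion_of_finite`, and these agree,
`natCard_gvSelmer_eq_of_equiv`). For `M_i = E_i[p^∞]`, `L = ℚ_∞`, `n = p`, `μ_i = 0`: with the
printed half of Prop. (2.8) (`#S^{Σ₀}_{A_i}[p] = p^{λ^{Σ₀}_{E_i}}`) this reads
`λ^{Σ₀}_{E₁} + dim E₁(ℚ_∞)[p] = λ^{Σ₀}_{E₂} + dim E₂(ℚ_∞)[p]` — GV's p. 27 conclusion
`λ^{Σ₀}_{E₁} = λ^{Σ₀}_{E₂}` corrected for `E_i(ℚ)[p] ≠ 0` (X1R0-GAPMAP §16.0; flag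
`GV-Prop28-H0-remark`).
[cite: GreenbergVatsal2000, §2 Prop. (2.8) and pp. 26–27] -/
theorem natCard_gvSelmer_inf_torsion_mul_eq
    (hM₁ : ∀ m : M₁, Continuous fun g : absoluteGaloisGroup K ↦ g • m)
    (hM₂ : ∀ m : M₂, Continuous fun g : absoluteGaloisGroup K ↦ g • m)
    (hdiv₁ : ∀ m : M₁, ∃ m' : M₁, n • m' = m) (hdiv₂ : ∀ m : M₂, ∃ m' : M₂, n • m' = m)
    (hunr₁ : ∀ v : HeightOneSpectrum (𝓞 K), v ∉ S₀ → ((p : ℕ) : 𝓞 K) ∉ v.asIdeal →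
      ∀ x ∈ inertia v, ∀ m : M₁, x • m = m)
    (hunr₂ : ∀ v : HeightOneSpectrum (𝓞 K), v ∉ S₀ → ((p : ℕ) : 𝓞 K) ∉ v.asIdeal →
      ∀ x ∈ inertia v, ∀ m : M₂, x • m = m)
    (htriv₁ : ∀ (v : HeightOneSpectrum (𝓞 K)) (hv : ((p : ℕ) : 𝓞 K) ∈ v.asIdeal),
      ∀ x ∈ inertia v, ∀ m : M₁, x • m - m ∈ (L₁ v hv).plus)
    (htriv₂ : ∀ (v : HeightOneSpectrum (𝓞 K)) (hv : ((p : ℕ) : 𝓞 K) ∈ v.asIdeal),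
      ∀ x ∈ inertia v, ∀ m : M₂, x • m - m ∈ (L₂ v hv).plus)
    [Finite (invariants H M₁)] [Finite (invariants H M₂)]
    (θ : M₁[(n : ℤ)] ≃+ M₂[(n : ℤ)])
    (hθ : ∀ (g : absoluteGaloisGroup K) (m : M₁[(n : ℤ)]), θ (g • m) = g • θ m)
    (hθL : ∀ (v : HeightOneSpectrum (𝓞 K)) (hv : ((p : ℕ) : 𝓞 K) ∈ v.asIdeal),
      (torsionData L₁ n v hv).plus.map (θ : M₁[(n : ℤ)] →+ M₂[(n : ℤ)]) =
        (torsionData L₂ n v hv).plus) :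
    Nat.card (gvSelmer H M₁ p L₁ S₀ ⊓ (subgroupH1 H M₁)[(n : ℤ)] : AddSubgroup (subgroupH1 H M₁)) *
        Nat.card ((invariants H M₁)[(n : ℤ)]) =
      Nat.card (gvSelmer H M₂ p L₂ S₀ ⊓ (subgroupH1 H M₂)[(n : ℤ)] :
          AddSubgroup (subgroupH1 H M₂)) * Nat.card ((invariants H M₂)[(n : ℤ)]) := by
  rw [← natCard_gvSelmer_torsion_of_finite H M₁ p L₁ S₀ n hM₁ hdiv₁ hunr₁ htriv₁,
    ← natCard_gvSelmer_torsion_of_finite H M₂ p L₂ S₀ n hM₂ hdiv₂ hunr₂ htriv₂]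
  exact natCard_gvSelmer_eq_of_equiv H θ (torsionData L₁ n) (torsionData L₂ n) S₀ hθL hθ

end Summit.BirchSwinnertonDyer.Rank1Residual.X2.GreenbergVatsalTorsionIso

end
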